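import Summits.ResolutionOfSingularities.ResolutionOfSingularities.Theorems.FrobeniusLadderFInjectiveMacaulayficationTwoLevelFrame
import Summits.ResolutionOfSingularities.ResolutionOfSingularities.Theorems.FrobeniusLadderFInjectiveMacaulayficationAffineBlowupChartTransport
import Summits.ResolutionOfSingularities.ResolutionOfSingularities.Theorems.FrobeniusLadderFInjectiveMacaulayficationFibreIdealOfBasePoint
import Summits.ResolutionOfSingularities.ResolutionOfSingularities.Theorems.FrobeniusLadderFInjectiveMacaulayficationBlowupFiModelOfCover
import Literature.AlgebraicGeometry.Resolution.BlowupChartTransition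
import Summits.ResolutionOfSingularities.ResolutionOfSingularities.Theorems.FrobeniusLadderFInjectiveMacaulayficationCertifiedCoverCongr
import HarnessLib

/-!
# E7 — THE TWO-LEVEL ROAD FRAME: `TwoLevelFrame` with the Rees charts of the first centre and their POLYNOMIAL MODELS wired in
# (crux `FInjectiveMacaulayfication` stmt-ResolutionOfSingularities-15315, chain w45a; E7 T₁₁/3 instance wiring v2, STATUS 2026-08-27T12:20:51Z)

[OURS · L1 W4.5a · res-L1-w45a-lead-1 gen 5] Support file (`--supports stmt-ResolutionOfSingularities-15315 --as helper`) for the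
crux `FrobeniusLadder.FInjectiveMacaulayfication`; NOT a statement of any manuscript; AI-written, weaker than expert review.

`TwoLevelFrame.pointFixable_of_twoLevelData` (p529483) takes the level-1 charts `U c` of `X′ = affineBlowup I` ABSTRACTLY (cover,
domain / Noetherian / Jacobson / characteristic-`p` sections, fibre ideals `𝔟 c` with both directions `h𝔟 / h𝔟′`, and the chart clauses
`hchart c` off the bad curve). In every road instance these charts are the REES CHARTS `D₊(w_c t)` of generators `w_c ∈ I` whose
`t`-multiples radically cover the irrelevant ideal, their sections are the affine blow-up algebras `R[I/w_c]` (res-type-034's N5a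
`AffineBlowupChartFrame` / pinned form `AffineBlowupChartTransport.exists_sectionsEquiv_eq`), and the level-1 certificates are proved on
POLYNOMIAL MODELS `B c ≃+* R[I/w_c]` (the toric chart rings `k[y]/(g_c)` of (C1) `MonomialChartPresentationKernel`, clauses by
res-L1-w45a-stub-5's `KLocCellOff.honQuot_of_kLocCells_off'`). This file discharges ALL the level-1 scheme plumbing once:

* `pointFixable_of_chartModels` — INPUT: `R` a Noetherian domain of characteristic `p`, `I ≠ ⊥` with `I.radical = 𝔪_b` (`b` maximal),
  generators `w : Fin t → I` of a radical Rees cover, the bad-curve point `ξ` over `b`, for every chart a Jacobson Noetherian model ring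
  `B c` with isomorphisms `ε c : B c ≃+* R[I/w_c]` and the PINNED sections isomorphism `e c : Γ(X′, D₊(w_c t)) ≃+* R[I/w_c]`
  (`he`: compatible with the structure maps), model ideals `P″ c` (the curve's chart ideal; only the ONE-SIDED inclusion
  `e_c (𝓘(closure {ξ})(D₊(w_c t))) ≤ ε_c (P″ c)` «true curve ideal ≤ model ideal» is required — (R3a) of the wiring; `P″ c = ⊤` on
  charts missing the curve) and `𝔟″ c` with `ε_c (𝔟″ c) = 𝔪_b · R[I/w_c]`,
  and the MODEL CLAUSES `hmodel c`: the Cohen–Macaulay + Frobenius-closed clause at every maximal `Q″ ⊇ 𝔟″ c` of `B c` not containing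
  `P″ c`; plus `TwoLevelFrame`'s level-2 binders verbatim (`S hScover t₂ v hv hv0 hcov₂ hon`). OUTPUT: `PFix_p(𝒪_{Spec R, b})` (5e / `h0`
  currency), i.e. `TwoLevelFrame.pointFixable_of_twoLevelData` with `U, hUcover, hdom, hnoeth, hjac, hchar, 𝔟, h𝔟, h𝔟′, hchart`
  DISCHARGED (`BlowupFiModelOfCover.exists_mem_basicOpen_of_irrelevant_le_radical`, `affineBlowup.isIntegral`-free: domains via
  `R[I/w_c] ⊆ R_{w_c}`; `FibreIdealOfBasePoint.map_primeIdealOf_le(_iff)`; `AffineBlowupChartTransport.chartClause_transport` +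
  `map_fibreIdeal_eq`).

No definitions, no named facts; glue. [folklore]
-/

-- single-problem summit: the doubled namespace component is forced
set_option linter.dupNamespace false

noncomputable section

namespace Summit.ResolutionOfSingularities.ResolutionOfSingularities.Theorems.FInjectiveMacaulayfication.TwoLevelRoadFrame

open AlgebraicGeometry CategoryTheory TopologicalSpace Literature.AlgebraicGeometry.Resolution
open Summit.ResolutionOfSingularities.ResolutionOfSingularities.Theorems.FInjectiveMacaulayfication

/-- The image of an ideal under a ring isomorphism, pulled back along the same isomorphism, is the ideal. [folklore] -/
theorem map_map_symm {A B : Type} [CommRing A] [CommRing B] (f : A ≃+* B) (J : Ideal A) :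
    (J.map f).map f.symm = J := by
  rw [Ideal.map_symm]
  exact Ideal.comap_map_of_bijective f f.bijective

/-- The image of an ideal under the inverse of a ring isomorphism, pushed forward again, is the ideal. [folklore] -/
theorem map_symm_map {A B : Type} [CommRing A] [CommRing B] (f : A ≃+* B) (J : Ideal B) :
    (J.map f.symm).map f = J :=
  map_map_symm f.symm J

/-- **E7 TWO-LEVEL ROAD FRAME — `PFix_p(𝒪_{Spec R, b})` from the Rees charts of the first centre, their polynomial models, the
model clauses off the bad curve, and `TwoLevelFrame`'s level-2 data.** See the module docstring. [folklore] -/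
theorem pointFixable_of_chartModels (p : ℕ) [Fact p.Prime]
    (R : Type) [CommRing R] [IsDomain R] [IsNoetherianRing R] [CharP R p]
    (I : Ideal R) (hI0 : I ≠ ⊥) (b : ↥(Spec (.of R))) (hbmax : b.asIdeal.IsMaximal) (hIb : I.radical = b.asIdeal)
    -- the Rees charts of generators `w c ∈ I` radically covering the irrelevant ideal
    (t : ℕ) (w : Fin t → R) (hw : ∀ c : Fin t, w c ∈ I) (hw0 : ∀ c : Fin t, w c ≠ 0)
    (hcover : (HomogeneousIdeal.irrelevant (reesGrading I)).toIdeal ≤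
      (Ideal.span (Set.range fun c : Fin t => reesT (I := I) (w c) (hw c))).radical)
    -- the pinned sections isomorphisms of the charts (`AffineBlowupChartTransport.exists_sectionsEquiv_eq` ∘ `compat_of_sectionsEquiv_eq`)
    (e : ∀ c : Fin t, Γ(affineBlowup I, Proj.basicOpen (reesGrading I) (reesT (I := I) (w c) (hw c))) ≃+* ↥(blowupAlgebra I (w c)))
    (he : ∀ (c : Fin t) (r : R), e c ((affineBlowup.π I).appLE ⊤ (Proj.basicOpen (reesGrading I) (reesT (I := I) (w c) (hw c))) le_top
      ((Scheme.ΓSpecIso (CommRingCat.of R)).inv r)) = algebraMap R (blowupAlgebra I (w c)) r)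
    -- the polynomial models of the charts
    (B : Fin t → Type) [∀ c, CommRing (B c)] [∀ c, IsNoetherianRing (B c)] [∀ c, IsJacobsonRing (B c)]
    (ε : ∀ c : Fin t, B c ≃+* ↥(blowupAlgebra I (w c)))
    -- the generic point of the bad curve, over `b`
    (ξ : ↥(affineBlowup I)) (hξ : (affineBlowup.π I).base ξ = b)
    -- the curve's model ideals: only the one-sided inclusion (R3a) «true curve ideal ≤ model ideal» is needed at level 1
    (P'' : ∀ c : Fin t, Ideal (B c))
    (hP'' : ∀ c : Fin t, ((Scheme.IdealSheafData.vanishingIdeal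
      (⟨closure ({ξ} : Set ↥(affineBlowup I)), isClosed_closure⟩ : Closeds ↥(affineBlowup I))).ideal
        ⟨Proj.basicOpen (reesGrading I) (reesT (I := I) (w c) (hw c)),
          AffineBlowupChartFrame.isAffineOpen_basicOpen_reesT I (w c) (hw c)⟩).map (e c) ≤ (P'' c).map (ε c))
    -- the fibre's model ideals
    (𝔟'' : ∀ c : Fin t, Ideal (B c))
    (h𝔟'' : ∀ c : Fin t, (𝔟'' c).map (ε c) = b.asIdeal.map (algebraMap R (blowupAlgebra I (w c))))
    -- LEVEL-1 MODEL CLAUSES: the clause at the maximal ideals of the models over `b` off the curve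
    (hmodel : ∀ (c : Fin t) (Q'' : Ideal (B c)) [Q''.IsMaximal], ¬ P'' c ≤ Q'' → 𝔟'' c ≤ Q'' →
      ∀ d : ℕ, ringKrullDim (Localization.AtPrime Q'') = d → ∀ s : Fin d → Localization.AtPrime Q'',
        (Ideal.span (Set.range s)).radical.IsMaximal →
          RingTheory.Sequence.IsWeaklyRegular (Localization.AtPrime Q'') (List.ofFn s) ∧
          ∀ y : Localization.AtPrime Q'', (∃ n : ℕ, y ^ p ^ n ∈ Ideal.span
            ((fun z : Localization.AtPrime Q'' => z ^ p ^ n) ''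
              (Ideal.span (Set.range s) : Set (Localization.AtPrime Q'')))) → y ∈ Ideal.span (Set.range s))
    -- HON CHARTS + LEVEL 2 (verbatim `TwoLevelFrame` binders on the Rees charts)
    (S : Set (Fin t)) (hScover : ∀ x' : ↥(affineBlowup I), x' ∈ closure ({ξ} : Set ↥(affineBlowup I)) →
      ∃ c ∈ S, x' ∈ Proj.basicOpen (reesGrading I) (reesT (I := I) (w c) (hw c)))
    (t₂ : S → ℕ) (v : ∀ σ : S, Fin (t₂ σ) → Γ(affineBlowup I, Proj.basicOpen (reesGrading I) (reesT (I := I) (w σ) (hw σ))))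
    (hv : ∀ (σ : S) (j : Fin (t₂ σ)), v σ j ∈ (Scheme.IdealSheafData.vanishingIdeal (⟨closure ({ξ} : Set ↥(affineBlowup I)), isClosed_closure⟩ :
          Closeds ↥(affineBlowup I))).ideal ⟨Proj.basicOpen (reesGrading I) (reesT (I := I) (w σ) (hw σ)),
          AffineBlowupChartFrame.isAffineOpen_basicOpen_reesT I (w σ) (hw σ)⟩)
    (hv0 : ∀ (σ : S) (j : Fin (t₂ σ)), v σ j ≠ 0)
    (hcov₂ : ∀ σ : S, (HomogeneousIdeal.irrelevant (reesGrading ((Scheme.IdealSheafData.vanishingIdeal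
        (⟨closure ({ξ} : Set ↥(affineBlowup I)), isClosed_closure⟩ : Closeds ↥(affineBlowup I))).ideal
          ⟨Proj.basicOpen (reesGrading I) (reesT (I := I) (w σ) (hw σ)),
            AffineBlowupChartFrame.isAffineOpen_basicOpen_reesT I (w σ) (hw σ)⟩))).toIdeal ≤
      (Ideal.span (Set.range fun j : Fin (t₂ σ) => reesT (I := (Scheme.IdealSheafData.vanishingIdeal
        (⟨closure ({ξ} : Set ↥(affineBlowup I)), isClosed_closure⟩ : Closeds ↥(affineBlowup I))).ideal
          ⟨Proj.basicOpen (reesGrading I) (reesT (I := I) (w σ) (hw σ)),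
            AffineBlowupChartFrame.isAffineOpen_basicOpen_reesT I (w σ) (hw σ)⟩) (v σ j) (hv σ j))).radical)
    (hon : ∀ (σ : S) (j : Fin (t₂ σ)) (Q : Ideal (blowupAlgebra ((Scheme.IdealSheafData.vanishingIdeal
        (⟨closure ({ξ} : Set ↥(affineBlowup I)), isClosed_closure⟩ : Closeds ↥(affineBlowup I))).ideal
          ⟨Proj.basicOpen (reesGrading I) (reesT (I := I) (w σ) (hw σ)),
            AffineBlowupChartFrame.isAffineOpen_basicOpen_reesT I (w σ) (hw σ)⟩) (v σ j))) [Q.IsMaximal],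
      algebraMap Γ(affineBlowup I, Proj.basicOpen (reesGrading I) (reesT (I := I) (w σ) (hw σ))) _ (v σ j) ∈ Q →
      ((((⟨⊤, isAffineOpen_top (Spec (CommRingCat.of R))⟩ : (Spec (CommRingCat.of R)).affineOpens).2.primeIdealOf
          ⟨b, show b ∈ ((⟨⊤, isAffineOpen_top (Spec (CommRingCat.of R))⟩ : (Spec (CommRingCat.of R)).affineOpens) :
            (Spec (CommRingCat.of R)).Opens) from trivial⟩).asIdeal.map ((affineBlowup.π I).appLE
          ((⟨⊤, isAffineOpen_top (Spec (CommRingCat.of R))⟩ : (Spec (CommRingCat.of R)).affineOpens) : (Spec (CommRingCat.of R)).Opens)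
          (Proj.basicOpen (reesGrading I) (reesT (I := I) (w σ) (hw σ))) le_top).hom)).map
        (algebraMap Γ(affineBlowup I, Proj.basicOpen (reesGrading I) (reesT (I := I) (w σ) (hw σ))) _) ≤ Q →
      ∀ d : ℕ, ringKrullDim (Localization.AtPrime Q) = d → ∀ s : Fin d → Localization.AtPrime Q,
        (Ideal.span (Set.range s)).radical.IsMaximal →
          RingTheory.Sequence.IsWeaklyRegular (Localization.AtPrime Q) (List.ofFn s) ∧
          ∀ y : Localization.AtPrime Q, (∃ n : ℕ, y ^ p ^ n ∈ Ideal.span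
            ((fun z : Localization.AtPrime Q => z ^ p ^ n) ''
              (Ideal.span (Set.range s) : Set (Localization.AtPrime Q)))) → y ∈ Ideal.span (Set.range s)) :
    ∃ (n : ℕ) (c : Fin n → (Spec (.of R)).presheaf.stalk b), Ideal.span (Set.range c) ≠ ⊥ ∧
      (Ideal.span (Set.range c)).radical = IsLocalRing.maximalIdeal ((Spec (.of R)).presheaf.stalk b) ∧
      ∀ (j : Fin n) (𝔔 : PrimeSpectrum (blowupAlgebra (Ideal.span (Set.range c)) (c j))),
        𝔔.asIdeal.comap (algebraMap ((Spec (.of R)).presheaf.stalk b) (blowupAlgebra (Ideal.span (Set.range c)) (c j))) =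
          IsLocalRing.maximalIdeal ((Spec (.of R)).presheaf.stalk b) →
        IsDomain (Localization.AtPrime 𝔔.asIdeal) ∧ ∀ d : ℕ, ringKrullDim (Localization.AtPrime 𝔔.asIdeal) = d →
          ∀ s : Fin d → Localization.AtPrime 𝔔.asIdeal, (Ideal.span (Set.range s)).radical.IsMaximal →
            RingTheory.Sequence.IsWeaklyRegular (Localization.AtPrime 𝔔.asIdeal) (List.ofFn s) ∧
            ∀ y : Localization.AtPrime 𝔔.asIdeal, (∃ n : ℕ, y ^ p ^ n ∈ Ideal.span
              ((fun z : Localization.AtPrime 𝔔.asIdeal => z ^ p ^ n) ''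
                (Ideal.span (Set.range s) : Set (Localization.AtPrime 𝔔.asIdeal)))) → y ∈ Ideal.span (Set.range s) := by
  classical
  have hp : p.Prime := Fact.out
  -- `b` is closed
  have hb : IsClosed ({b} : Set ↥(Spec (.of R))) := (PrimeSpectrum.isClosed_singleton_iff_isMaximal b).mpr hbmax
  -- the charts, as affine opens
  let U : Fin t → (affineBlowup I).affineOpens := fun c =>
    ⟨Proj.basicOpen (reesGrading I) (reesT (I := I) (w c) (hw c)), AffineBlowupChartFrame.isAffineOpen_basicOpen_reesT I (w c) (hw c)⟩
  have hUcover : ∀ x' : ↥(affineBlowup I), ∃ c : Fin t, x' ∈ (U c : (affineBlowup I).Opens) := fun x' =>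
    BlowupFiModelOfCover.exists_mem_basicOpen_of_irrelevant_le_radical w hw hcover x'
  -- instances on the affine blow-up algebras `R[I/w_c]`
  have hwnzd : ∀ c : Fin t, w c ∈ nonZeroDivisors R := fun c => mem_nonZeroDivisors_of_ne_zero (hw0 c)
  have hdomA : ∀ c : Fin t, IsDomain ↥(blowupAlgebra I (w c)) := fun c => by
    haveI : IsDomain (Localization.Away (w c)) :=
      IsLocalization.isDomain_localization ((Submonoid.powers_le (P := nonZeroDivisors R)).mpr (hwnzd c))
    infer_instance
  have hinjA : ∀ c : Fin t, Function.Injective (algebraMap R ↥(blowupAlgebra I (w c))) := fun c => by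
    intro x y hxy
    have h1 : algebraMap R (Localization.Away (w c)) x = algebraMap R (Localization.Away (w c)) y := by
      have := congrArg (fun z : ↥(blowupAlgebra I (w c)) => (z : Localization.Away (w c))) hxy
      simpa using this
    exact IsLocalization.injective (Localization.Away (w c)) ((Submonoid.powers_le (P := nonZeroDivisors R)).mpr (hwnzd c)) h1
  have hcharA : ∀ c : Fin t, CharP ↥(blowupAlgebra I (w c)) p := fun c =>
    charP_of_injective_algebraMap (hinjA c) p
  -- the section rings of the charts
  have hdom : ∀ c : Fin t, IsDomain Γ(affineBlowup I, U c) := fun c => by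
    haveI := hdomA c
    exact MulEquiv.isDomain (↥(blowupAlgebra I (w c))) (e c).toMulEquiv
  have hnoeth : ∀ c : Fin t, IsNoetherianRing Γ(affineBlowup I, U c) := fun c =>
    isNoetherianRing_of_ringEquiv (B c) ((ε c).trans (e c).symm)
  have hjac : ∀ c : Fin t, IsJacobsonRing Γ(affineBlowup I, U c) := fun c =>
    isJacobsonRing_of_surjective ⟨((ε c).trans (e c).symm).toRingHom, ((ε c).trans (e c).symm).surjective⟩
  have hchar : ∀ c : Fin t, CharP Γ(affineBlowup I, U c) p := fun c => by
    haveI := hcharA c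
    exact charP_of_injective_ringHom (f := (e c).symm.toRingHom) (e c).symm.injective p
  -- the fibre ideals `𝔟 c := 𝔭_b · Γ(X′, U c)`
  let V₀ : (Spec (CommRingCat.of R)).affineOpens := ⟨⊤, isAffineOpen_top (Spec (CommRingCat.of R))⟩
  have hbV : b ∈ (V₀ : (Spec (CommRingCat.of R)).Opens) := trivial
  let 𝔟 : ∀ c : Fin t, Ideal Γ(affineBlowup I, U c) := fun c =>
    ((V₀.2.primeIdealOf ⟨b, hbV⟩).asIdeal).map ((affineBlowup.π I).appLE V₀ (U c) le_top).hom
  have h𝔟 : ∀ (c : Fin t) (z : ↥(Spec Γ(affineBlowup I, U c))),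
      (affineBlowup.π I).base ((U c).2.fromSpec.base z) = b → 𝔟 c ≤ z.asIdeal := fun c z hz =>
    FibreIdealOfBasePoint.map_primeIdealOf_le (affineBlowup.π I) b V₀ hbV (U c) le_top z hz
  have h𝔟' : ∀ (c : Fin t) (z : ↥(Spec Γ(affineBlowup I, U c))),
      𝔟 c ≤ z.asIdeal → (affineBlowup.π I).base ((U c).2.fromSpec.base z) = b := fun c z hz =>
    (FibreIdealOfBasePoint.map_primeIdealOf_le_iff (affineBlowup.π I) b hb V₀ hbV (U c) le_top z).mp hz
  -- the fibre ideals in the models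
  have h𝔟e : ∀ c : Fin t, (𝔟 c).map (e c) = b.asIdeal.map (algebraMap R (blowupAlgebra I (w c))) := fun c =>
    AffineBlowupChartTransport.map_fibreIdeal_eq I (w c) (hw c) (e c) (he c) b hbV
  have h𝔟f : ∀ c : Fin t, (𝔟 c).map ((e c).trans (ε c).symm) = 𝔟'' c := fun c => by
    rw [AffineBlowupChartTransport.map_trans, h𝔟e c, ← h𝔟'' c]
    exact map_map_symm (ε c) (𝔟'' c)
  -- the model curve ideals pulled back to the section rings: `J₂(U c) ≤ J c := e_c⁻¹ (ε_c (P″ c))`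
  let J : ∀ c : Fin t, Ideal Γ(affineBlowup I, U c) := fun c => ((P'' c).map (ε c)).map (e c).symm
  have hJf : ∀ c : Fin t, (J c).map ((e c).trans (ε c).symm) = P'' c := fun c => by
    dsimp only [J]
    rw [AffineBlowupChartTransport.map_trans, map_symm_map (e c) ((P'' c).map (ε c))]
    exact map_map_symm (ε c) (P'' c)
  have hJle : ∀ c : Fin t, (Scheme.IdealSheafData.vanishingIdeal (⟨closure ({ξ} : Set ↥(affineBlowup I)), isClosed_closure⟩ :
      Closeds ↥(affineBlowup I))).ideal (U c) ≤ J c := fun c => by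
    have h1 := Ideal.map_mono (f := (e c).symm.toRingHom) (hP'' c)
    have h2 : (((Scheme.IdealSheafData.vanishingIdeal (⟨closure ({ξ} : Set ↥(affineBlowup I)), isClosed_closure⟩ :
        Closeds ↥(affineBlowup I))).ideal (U c)).map (e c)).map (e c).symm =
        (Scheme.IdealSheafData.vanishingIdeal (⟨closure ({ξ} : Set ↥(affineBlowup I)), isClosed_closure⟩ :
          Closeds ↥(affineBlowup I))).ideal (U c) := map_map_symm (e c) _
    exact le_of_eq_of_le h2.symm h1
  -- LEVEL-1 CHART CLAUSES by transport from the models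
  have hchart : ∀ (c : Fin t) (Q : Ideal Γ(affineBlowup I, U c)) [Q.IsMaximal],
      ¬ (Scheme.IdealSheafData.vanishingIdeal (⟨closure ({ξ} : Set ↥(affineBlowup I)), isClosed_closure⟩ :
          Closeds ↥(affineBlowup I))).ideal (U c) ≤ Q → 𝔟 c ≤ Q →
      ∀ d : ℕ, ringKrullDim (Localization.AtPrime Q) = d → ∀ s : Fin d → Localization.AtPrime Q,
        (Ideal.span (Set.range s)).radical.IsMaximal →
          RingTheory.Sequence.IsWeaklyRegular (Localization.AtPrime Q) (List.ofFn s) ∧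
          ∀ y : Localization.AtPrime Q, (∃ n : ℕ, y ^ p ^ n ∈ Ideal.span
            ((fun z : Localization.AtPrime Q => z ^ p ^ n) ''
              (Ideal.span (Set.range s) : Set (Localization.AtPrime Q)))) → y ∈ Ideal.span (Set.range s) := by
    intro c Q _ hQJ hQb
    exact AffineBlowupChartTransport.chartClause_transport p ((e c).trans (ε c).symm) (J c) (𝔟 c) (P'' c) (𝔟'' c) (hJf c) (h𝔟f c)
      (fun Q'' _ hQ''J hQ''b => hmodel c Q'' hQ''J hQ''b) Q (fun hle => hQJ ((hJle c).trans hle)) hQb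
  -- the frame
  exact TwoLevelFrame.pointFixable_of_twoLevelData p R I hI0 b hbmax hIb ξ hξ U hUcover hdom hnoeth hjac hchar 𝔟 h𝔟 h𝔟' hchart
    S (fun x' hx' => hScover x' hx') t₂ v hv hv0 hcov₂ hon

/-- A certificate block (COV) ∧ (NZ) ∧ (HON) for an ideal is one for any EQUAL ideal (the ideal enters the types of the blow-up
algebras, so this is a `subst`, stated once). [folklore] -/
theorem block_of_eq (p : ℕ) {A : Type} [CommRing A] {P P' : Ideal A} (hPP' : P = P')
    (h : ∃ (t : ℕ) (v : Fin t → A) (hv : ∀ j : Fin t, v j ∈ P),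
          (HomogeneousIdeal.irrelevant (reesGrading P)).toIdeal ≤ (Ideal.span (Set.range fun j : Fin t => reesT (I := P) (v j) (hv j))).radical ∧
          (∀ j : Fin t, v j ≠ 0) ∧
          ∀ (j : Fin t) (Q : Ideal (blowupAlgebra P (v j))) [Q.IsMaximal],
            algebraMap A (blowupAlgebra P (v j)) (v j) ∈ Q →
            ∀ d : ℕ, ringKrullDim (Localization.AtPrime Q) = d → ∀ s : Fin d → Localization.AtPrime Q,
              (Ideal.span (Set.range s)).radical.IsMaximal → RingTheory.Sequence.IsWeaklyRegular (Localization.AtPrime Q) (List.ofFn s) ∧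
              ∀ y : Localization.AtPrime Q, (∃ e : ℕ, y ^ p ^ e ∈ Ideal.span ((fun z : Localization.AtPrime Q => z ^ p ^ e) ''
                (Ideal.span (Set.range s) : Set (Localization.AtPrime Q)))) → y ∈ Ideal.span (Set.range s)) :
    ∃ (t : ℕ) (v : Fin t → A) (hv : ∀ j : Fin t, v j ∈ P'),
          (HomogeneousIdeal.irrelevant (reesGrading P')).toIdeal ≤ (Ideal.span (Set.range fun j : Fin t => reesT (I := P') (v j) (hv j))).radical ∧
          (∀ j : Fin t, v j ≠ 0) ∧
          ∀ (j : Fin t) (Q : Ideal (blowupAlgebra P' (v j))) [Q.IsMaximal],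
            algebraMap A (blowupAlgebra P' (v j)) (v j) ∈ Q →
            ∀ d : ℕ, ringKrullDim (Localization.AtPrime Q) = d → ∀ s : Fin d → Localization.AtPrime Q,
              (Ideal.span (Set.range s)).radical.IsMaximal → RingTheory.Sequence.IsWeaklyRegular (Localization.AtPrime Q) (List.ofFn s) ∧
              ∀ y : Localization.AtPrime Q, (∃ e : ℕ, y ^ p ^ e ∈ Ideal.span ((fun z : Localization.AtPrime Q => z ^ p ^ e) ''
                (Ideal.span (Set.range s) : Set (Localization.AtPrime Q)))) → y ∈ Ideal.span (Set.range s) := by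
  subst hPP'
  exact h

/-- **E7 TWO-LEVEL ROAD FRAME, BOTH LEVELS ON THE MODELS.** As `pointFixable_of_chartModels`, but the level-2 data are given on the
polynomial models too: for every hon chart `σ ∈ S` a model ideal `I₂ σ` of `B σ` with the EQUALITY (R3b)
`e_σ (𝓘(closure {ξ})(D₊(w_σ t))) = ε_σ (I₂ σ)` and a CERTIFICATE BLOCK (COV) ∧ (NZ) ∧ (HON) for `(B σ, I₂ σ)` in the shape of
`CertifiedCoverCongr.cert_congr` (generators `w₂ j ∈ I₂ σ` of a radical Rees cover, nonzero, and the clause at every maximal ideal of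
`(B σ)[I₂ σ / w₂ j]` containing `w₂ j/1` — res-type-034's N3 `TranslatedRelativeCN.hon_translated` supplies (HON) for translated lines).
The block is moved to `Γ(X′, D₊(w_σ t))` by `cert_congr` along `ε_σ ≫ e_σ⁻¹` and `block_of_eq`, and `pointFixable_of_chartModels` concludes.
[folklore] -/
theorem pointFixable_of_chartModels₂ (p : ℕ) [Fact p.Prime]
    (R : Type) [CommRing R] [IsDomain R] [IsNoetherianRing R] [CharP R p]
    (I : Ideal R) (hI0 : I ≠ ⊥) (b : ↥(Spec (.of R))) (hbmax : b.asIdeal.IsMaximal) (hIb : I.radical = b.asIdeal)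
    (t : ℕ) (w : Fin t → R) (hw : ∀ c : Fin t, w c ∈ I) (hw0 : ∀ c : Fin t, w c ≠ 0)
    (hcover : (HomogeneousIdeal.irrelevant (reesGrading I)).toIdeal ≤
      (Ideal.span (Set.range fun c : Fin t => reesT (I := I) (w c) (hw c))).radical)
    (e : ∀ c : Fin t, Γ(affineBlowup I, Proj.basicOpen (reesGrading I) (reesT (I := I) (w c) (hw c))) ≃+* ↥(blowupAlgebra I (w c)))
    (he : ∀ (c : Fin t) (r : R), e c ((affineBlowup.π I).appLE ⊤ (Proj.basicOpen (reesGrading I) (reesT (I := I) (w c) (hw c))) le_top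
      ((Scheme.ΓSpecIso (CommRingCat.of R)).inv r)) = algebraMap R (blowupAlgebra I (w c)) r)
    (B : Fin t → Type) [∀ c, CommRing (B c)] [∀ c, IsNoetherianRing (B c)] [∀ c, IsJacobsonRing (B c)]
    (ε : ∀ c : Fin t, B c ≃+* ↥(blowupAlgebra I (w c)))
    (ξ : ↥(affineBlowup I)) (hξ : (affineBlowup.π I).base ξ = b)
    (P'' : ∀ c : Fin t, Ideal (B c))
    (hP'' : ∀ c : Fin t, ((Scheme.IdealSheafData.vanishingIdeal
      (⟨closure ({ξ} : Set ↥(affineBlowup I)), isClosed_closure⟩ : Closeds ↥(affineBlowup I))).ideal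
        ⟨Proj.basicOpen (reesGrading I) (reesT (I := I) (w c) (hw c)),
          AffineBlowupChartFrame.isAffineOpen_basicOpen_reesT I (w c) (hw c)⟩).map (e c) ≤ (P'' c).map (ε c))
    (𝔟'' : ∀ c : Fin t, Ideal (B c))
    (h𝔟'' : ∀ c : Fin t, (𝔟'' c).map (ε c) = b.asIdeal.map (algebraMap R (blowupAlgebra I (w c))))
    (hmodel : ∀ (c : Fin t) (Q'' : Ideal (B c)) [Q''.IsMaximal], ¬ P'' c ≤ Q'' → 𝔟'' c ≤ Q'' →
      ∀ d : ℕ, ringKrullDim (Localization.AtPrime Q'') = d → ∀ s : Fin d → Localization.AtPrime Q'',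
        (Ideal.span (Set.range s)).radical.IsMaximal →
          RingTheory.Sequence.IsWeaklyRegular (Localization.AtPrime Q'') (List.ofFn s) ∧
          ∀ y : Localization.AtPrime Q'', (∃ n : ℕ, y ^ p ^ n ∈ Ideal.span
            ((fun z : Localization.AtPrime Q'' => z ^ p ^ n) ''
              (Ideal.span (Set.range s) : Set (Localization.AtPrime Q'')))) → y ∈ Ideal.span (Set.range s))
    -- HON CHARTS covering the curve
    (S : Set (Fin t)) (hScover : ∀ x' : ↥(affineBlowup I), x' ∈ closure ({ξ} : Set ↥(affineBlowup I)) →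
      ∃ c ∈ S, x' ∈ Proj.basicOpen (reesGrading I) (reesT (I := I) (w c) (hw c)))
    -- LEVEL 2 ON THE MODELS: the curve's model ideal with the (R3b) EQUALITY, and a certificate block for its blowing up
    (I₂ : ∀ σ : S, Ideal (B σ))
    (hI₂ : ∀ σ : S, ((Scheme.IdealSheafData.vanishingIdeal
      (⟨closure ({ξ} : Set ↥(affineBlowup I)), isClosed_closure⟩ : Closeds ↥(affineBlowup I))).ideal
        ⟨Proj.basicOpen (reesGrading I) (reesT (I := I) (w σ) (hw σ)),
          AffineBlowupChartFrame.isAffineOpen_basicOpen_reesT I (w σ) (hw σ)⟩).map (e σ) = (I₂ σ).map (ε σ))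
    (hblock : ∀ σ : S, ∃ (t₂ : ℕ) (w₂ : Fin t₂ → B σ) (hw₂ : ∀ j : Fin t₂, w₂ j ∈ I₂ σ),
          (HomogeneousIdeal.irrelevant (reesGrading (I₂ σ))).toIdeal ≤
            (Ideal.span (Set.range fun j : Fin t₂ => reesT (I := I₂ σ) (w₂ j) (hw₂ j))).radical ∧
          (∀ j : Fin t₂, w₂ j ≠ 0) ∧
          ∀ (j : Fin t₂) (Q : Ideal (blowupAlgebra (I₂ σ) (w₂ j))) [Q.IsMaximal],
            algebraMap (B σ) (blowupAlgebra (I₂ σ) (w₂ j)) (w₂ j) ∈ Q →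
            ∀ d : ℕ, ringKrullDim (Localization.AtPrime Q) = d → ∀ s : Fin d → Localization.AtPrime Q,
              (Ideal.span (Set.range s)).radical.IsMaximal → RingTheory.Sequence.IsWeaklyRegular (Localization.AtPrime Q) (List.ofFn s) ∧
              ∀ y : Localization.AtPrime Q, (∃ e : ℕ, y ^ p ^ e ∈ Ideal.span ((fun z : Localization.AtPrime Q => z ^ p ^ e) ''
                (Ideal.span (Set.range s) : Set (Localization.AtPrime Q)))) → y ∈ Ideal.span (Set.range s)) :
    ∃ (n : ℕ) (c : Fin n → (Spec (.of R)).presheaf.stalk b), Ideal.span (Set.range c) ≠ ⊥ ∧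
      (Ideal.span (Set.range c)).radical = IsLocalRing.maximalIdeal ((Spec (.of R)).presheaf.stalk b) ∧
      ∀ (j : Fin n) (𝔔 : PrimeSpectrum (blowupAlgebra (Ideal.span (Set.range c)) (c j))),
        𝔔.asIdeal.comap (algebraMap ((Spec (.of R)).presheaf.stalk b) (blowupAlgebra (Ideal.span (Set.range c)) (c j))) =
          IsLocalRing.maximalIdeal ((Spec (.of R)).presheaf.stalk b) →
        IsDomain (Localization.AtPrime 𝔔.asIdeal) ∧ ∀ d : ℕ, ringKrullDim (Localization.AtPrime 𝔔.asIdeal) = d →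
          ∀ s : Fin d → Localization.AtPrime 𝔔.asIdeal, (Ideal.span (Set.range s)).radical.IsMaximal →
            RingTheory.Sequence.IsWeaklyRegular (Localization.AtPrime 𝔔.asIdeal) (List.ofFn s) ∧
            ∀ y : Localization.AtPrime 𝔔.asIdeal, (∃ n : ℕ, y ^ p ^ n ∈ Ideal.span
              ((fun z : Localization.AtPrime 𝔔.asIdeal => z ^ p ^ n) ''
                (Ideal.span (Set.range s) : Set (Localization.AtPrime 𝔔.asIdeal)))) → y ∈ Ideal.span (Set.range s) := by
  classical
  -- move each model block to the section ring of its chart, for the TRUE curve ideal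
  have hA : ∀ σ : S, ∃ (t₂ : ℕ) (v : Fin t₂ → Γ(affineBlowup I, Proj.basicOpen (reesGrading I) (reesT (I := I) (w σ) (hw σ))))
      (hv : ∀ j : Fin t₂, v j ∈ (Scheme.IdealSheafData.vanishingIdeal (⟨closure ({ξ} : Set ↥(affineBlowup I)), isClosed_closure⟩ :
          Closeds ↥(affineBlowup I))).ideal ⟨Proj.basicOpen (reesGrading I) (reesT (I := I) (w σ) (hw σ)),
          AffineBlowupChartFrame.isAffineOpen_basicOpen_reesT I (w σ) (hw σ)⟩),
        (HomogeneousIdeal.irrelevant (reesGrading ((Scheme.IdealSheafData.vanishingIdeal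
          (⟨closure ({ξ} : Set ↥(affineBlowup I)), isClosed_closure⟩ : Closeds ↥(affineBlowup I))).ideal
            ⟨Proj.basicOpen (reesGrading I) (reesT (I := I) (w σ) (hw σ)),
              AffineBlowupChartFrame.isAffineOpen_basicOpen_reesT I (w σ) (hw σ)⟩))).toIdeal ≤
          (Ideal.span (Set.range fun j : Fin t₂ => reesT (I := (Scheme.IdealSheafData.vanishingIdeal
            (⟨closure ({ξ} : Set ↥(affineBlowup I)), isClosed_closure⟩ : Closeds ↥(affineBlowup I))).ideal
              ⟨Proj.basicOpen (reesGrading I) (reesT (I := I) (w σ) (hw σ)),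
                AffineBlowupChartFrame.isAffineOpen_basicOpen_reesT I (w σ) (hw σ)⟩) (v j) (hv j))).radical ∧
        (∀ j : Fin t₂, v j ≠ 0) ∧
        ∀ (j : Fin t₂) (Q : Ideal (blowupAlgebra ((Scheme.IdealSheafData.vanishingIdeal
            (⟨closure ({ξ} : Set ↥(affineBlowup I)), isClosed_closure⟩ : Closeds ↥(affineBlowup I))).ideal
              ⟨Proj.basicOpen (reesGrading I) (reesT (I := I) (w σ) (hw σ)),
                AffineBlowupChartFrame.isAffineOpen_basicOpen_reesT I (w σ) (hw σ)⟩) (v j))) [Q.IsMaximal],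
          algebraMap Γ(affineBlowup I, Proj.basicOpen (reesGrading I) (reesT (I := I) (w σ) (hw σ))) _ (v j) ∈ Q →
          ∀ d : ℕ, ringKrullDim (Localization.AtPrime Q) = d → ∀ s : Fin d → Localization.AtPrime Q,
            (Ideal.span (Set.range s)).radical.IsMaximal → RingTheory.Sequence.IsWeaklyRegular (Localization.AtPrime Q) (List.ofFn s) ∧
            ∀ y : Localization.AtPrime Q, (∃ e : ℕ, y ^ p ^ e ∈ Ideal.span ((fun z : Localization.AtPrime Q => z ^ p ^ e) ''
              (Ideal.span (Set.range s) : Set (Localization.AtPrime Q)))) → y ∈ Ideal.span (Set.range s) := by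
    intro σ
    have hmoved := CertifiedCoverCongr.cert_congr p ((ε σ).trans (e σ).symm) (I₂ σ) (hblock σ)
    refine block_of_eq p ?_ hmoved
    rw [AffineBlowupChartTransport.map_trans, ← hI₂ σ]
    exact map_map_symm (e σ) _
  choose t₂ v hv hcov₂ hv0 hon using hA
  exact pointFixable_of_chartModels p R I hI0 b hbmax hIb t w hw hw0 hcover e he B ε ξ hξ P'' hP'' 𝔟'' h𝔟'' hmodel S hScover
    t₂ v hv hv0 hcov₂ (fun σ j Q _ hQ _ => hon σ j Q hQ)

end Summit.ResolutionOfSingularities.ResolutionOfSingularities.Theorems.FInjectiveMacaulayfication.TwoLevelRoadFrame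

end
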